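import Mathlib
import Literature.NumberTheory.Irrationality.CressonFischlerRivoal2008.WellPoisedSymmetry
import Literature.NumberTheory.Irrationality.Zudilin2002.WellPoisedForms
import Summits.KontsevichZagierPeriods.Zeta5Search.BrickPartialFractions
import Summits.KontsevichZagierPeriods.Zeta5Search.BrickTheoremTen

/-!
# BrickLinearForms — the brick kernel's series IS a linear form in zeta values with zi-p2's coefficients:
`Σ_{k≥1} R_n^{(A,B,ε)}(k) = Σ_{s=2}^{A} x_s(n)·ζ(s) + x_0(n)`, only ODD `s` in the very-well-poised case; the
`(6,1,1)` kernel is Zudilin's `rₙ = uₙζ(5) + wₙζ(3) − vₙ` (2002), so THEOREM 10 gives supercongruences mod `p³`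
for the printed `uₙ, wₙ, vₙ` (cell zeta5-irr)

HONEST FRAMING: systematic search; no irrationality claim unless certified. INSTRUMENT lemma of the ζ(5)
census cell zeta5-irr (HOME `run/shared/lean/pub/zeta5-irr/`). The tree's files `BrickPartialFractions` …
`BrickTheoremTen` prove zi-p2's THEOREMS 6–10 about the sums `x_s(n) = Σ_K c_{K,s}(n)` of the partial-fraction
cells of the brick kernel `R_n(t) = n!^{A−2B}(t+n/2)^ε(t−n)_n^B(t+n+1)_n^B/(t)_{n+1}^A` and `x_0(n) = −Σ_KΣ_s c_{K,s}H_K^{(s)}`,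
whose docstrings CALL `x_s(n)` «the coefficient of `ζ(s)` in the linear form `Σ_{t≥1}R_n(t)`». This file PROVES that
sentence and identifies the objects with a printed source, so that the capstone `BrickTheoremTen.theoremTen` can be
read on Zudilin's coefficients. Nothing here is about the arithmetic nature of ζ(5); no denominator saving; 0 nats/n;
rung F-Z1 NOT moved. Filed by the engine seat zi-eng (g11).

## What is PROVED (everything; standard axioms; no new definitions)

* `pfEval_cell`: the cells ARE partial-fraction data in the Ball–Rivoal/CFR convention
  (`Literature…BallRivoal.pfEval`), `brickKernel_succ_eq`: `R_n(t+1) = kerNum(t+1)/(t+1)_{n+1}^A`;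
* `xCoeff_one` (**`x_1(n) = 0`**, order `≥ 2` at infinity, `2B ≤ A`, `ε + 2 ≤ A`) and
  **`hasSum_brickKernel`**: `Σ_{k≥0} R_n(k+1) = Σ_{s∈[2,A]} x_s(n)·ζ(s) + x_0(n)` (`ζ(s) = zetaValue s`), via the
  Literature's `CressonFischlerRivoal2008.hasSum_partialFractions` / `partialFractions_sum_order_zero`;
* the very-well-poised reflection `kerNum_reflect` (`A` even, `ε` odd: `P(−n−X) = −P(X)`), hence
  `xCoeff_eq_zero_of_even` (**`x_s(n) = 0` for even `s ≥ 2`**, CFR `partialFractions_sum_odd_order`) and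
  **`hasSum_brickKernel_odd`**: `Σ_{k≥1} R_n(k) = Σ_{3≤s≤A, s odd} x_s(n)ζ(s) + x_0(n)`; the Ball kernel `(4,1,1)`:
  `hasSum_ball` (`= x_3(n)ζ(3) + x_0(n)`);
* **Zudilin 2002 eq. (7) is the kernel `(6,1,1)`**: `eval_numR_eq_eval_kerNum`, `isDataR_cell`, `dataR_eq_cell`,
  `uC_eq_xCoeff` (`uₙ = x_5(n)`), `wC_eq_xCoeff` (`wₙ = x_3(n)`), `vC_eq_neg_xZero` (`vₙ = −x_0(n)`), `rForm_eq_xCoeff`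
  (objects of `Literature.NumberTheory.Irrationality.Zudilin2002.WellPoisedForms`);
* COROLLARIES of THEOREM 10 (viii) (`BrickTheoremTen.theoremTen`, every prime `p ≥ 5`): **`uC_congr`**
  `v_p(u_{np} − u_n) ≥ 3` for EVERY `n` (i.e. `u_{np} ≡ u_n (mod p³)` for Zudilin's `ζ(5)`-coefficients `uₙ`);
  **`wC_congr`** `p^{2(L+1)}w_{np} ≡ p^{2L}w_n (mod p³)` and **`vC_congr`** `p^{5(L+1)}v_{np} ≡ p^{5L}v_n (mod p³)` for
  `n < p^{L+1}`; the Ball kernel: `ball_congr` (`x_3(np) ≡ x_3(n)`, `p^{3(L+1)}x_0(np) ≡ p^{3L}x_0(n) (mod p³)`).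
  Valuations are written as in the chain: `Rat.padicValuation p x ≤ exp(−3)` ⟺ `x = 0 ∨ ord_p(x) ≥ 3`.

WHAT THIS IS NOT: not an irrationality statement; `uₙ, wₙ, vₙ` are the coefficients of Zudilin's auxiliary very-well-poised
forms `rₙ` (his recursion's `qₙ, pₙ, p̃ₙ` are 2×2 minors of them, `Zudilin2002.tendsto_of_minors_isSolution`), and the
congruences say nothing about sizes or denominators.
-/

namespace Summit.KontsevichZagierPeriods.Zeta5Search.BrickLinearForms

open Finset Nat Polynomial WithZero
open Literature.NumberTheory.Transcendental (zetaValue)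
open Literature.NumberTheory.Transcendental.BallRivoal (pfEval poch harm)
open Literature.NumberTheory.Irrationality.CressonFischlerRivoal2008 (hasSum_partialFractions
  partialFractions_sum_order_zero partialFractions_sum_odd_order)
open Literature.NumberTheory.Irrationality.Zudilin2002 (numR IsDataR dataR isDataR_dataR IsDataR.eq uC wC vC rForm
  rForm_eq eval_numR)
open Summit.KontsevichZagierPeriods.Zeta5Search.BrickKernelFrobenius (brickKernel)
open Summit.KontsevichZagierPeriods.Zeta5Search.BrickLaurent (cell kerNum kerDen brickKernel_eq_div eval_kerNum
  eval_kerDen)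
open Summit.KontsevichZagierPeriods.Zeta5Search.BrickPartialFractions (xCoeff cellZero xZero brickKernel_eq_sum_cell
  natDegree_kerNum_le)
open Summit.KontsevichZagierPeriods.Zeta5Search.BrickTheoremTen (theoremTen theoremTen_all)

noncomputable section

/-! ## The cells as Ball–Rivoal partial-fraction data -/

/-- `kerDen(t) = ((t)_{n+1})^A` in the Ball–Rivoal Pochhammer notation `poch t k = ∏_{s<k}(t+s)`. -/
theorem eval_kerDen_eq_poch (A n : ℕ) (t : ℚ) : (kerDen A n).eval t = poch t (n + 1) ^ A := by
  rw [eval_kerDen]; rfl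

/-- The kernel in the shifted variable `k = t + 1`: `R_n(t+1) = Q(t)/((t+1)_{n+1})^A` with `Q = kerNum ∘ (X+1)`. -/
theorem brickKernel_succ_eq (A B ε n : ℕ) (t : ℚ) :
    brickKernel A B ε n (t + 1) = ((kerNum A B ε n).comp (X + C 1)).eval t / poch (t + 1) (n + 1) ^ A := by
  rw [brickKernel_eq_div, eval_kerDen_eq_poch, eval_comp, eval_add, eval_X, eval_C]

/-- **The cells ARE partial-fraction data** (convention of `BallRivoal.pfEval`: `c o K` is the coefficient of
`(t+K+1)^{−(o+1)}`): for `2B ≤ A`, `ε < A` and `t` off the poles,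
`Σ_{K≤n} Σ_{o<A} c_{K,o+1}(n)/(t+K+1)^{o+1} = R_n(t+1)` (the tree's `brickKernel_eq_sum_cell`, re-indexed). -/
theorem pfEval_cell {A B : ℕ} (hAB : 2 * B ≤ A) {ε : ℕ} (hε : ε < A) (n : ℕ) {t : ℚ}
    (ht : ∀ m, m ≤ n → t + m + 1 ≠ 0) :
    pfEval n A (fun o K => cell A B ε n K (o + 1)) t = brickKernel A B ε n (t + 1) := by
  have ht' : ∀ m ≤ n, t + 1 + (m : ℚ) ≠ 0 := fun m hm => by rw [add_right_comm]; exact ht m hm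
  rw [brickKernel_eq_sum_cell hAB hε ht', pfEval]
  refine Finset.sum_congr rfl fun K _ => ?_
  rw [← Finset.Ico_add_one_right_eq_Icc, Finset.sum_Ico_eq_sum_range, Nat.add_sub_cancel]
  refine Finset.sum_congr rfl fun o _ => ?_
  rw [add_comm 1 o, add_right_comm t (1 : ℚ) (K : ℚ)]

/-! ## The order at infinity: no `ζ(1)` -/

/-- Degree bookkeeping: `deg(kerNum ∘ (X+1)) + 2 ≤ A(n+1)` for `2B ≤ A`, `ε + 2 ≤ A` (`deg kerNum = ε + 2nB`). -/
theorem natDegree_kerNum_comp_add_two_le {A B : ℕ} (hAB : 2 * B ≤ A) {ε : ℕ} (hε : ε + 2 ≤ A) (n : ℕ) :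
    ((kerNum A B ε n).comp (X + C 1)).natDegree + 2 ≤ A * (n + 1) := by
  rw [natDegree_comp, natDegree_X_add_C, mul_one]
  have h1 := natDegree_kerNum_le A B ε n
  have h2 : 2 * B * n ≤ A * n := Nat.mul_le_mul_right n hAB
  nlinarith

/-- **`x_1(n) = Σ_K c_{K,1}(n) = 0`**: the order of `R_n` at infinity is `≥ 2` (`2B ≤ A`, `ε + 2 ≤ A`), so the polar part
of order one sums to zero (Literature `CressonFischlerRivoal2008.partialFractions_sum_order_zero`). -/
theorem xCoeff_one {A B : ℕ} (hAB : 2 * B ≤ A) {ε : ℕ} (hε : ε + 2 ≤ A) (n : ℕ) : xCoeff A B ε n 1 = 0 := by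
  have h := partialFractions_sum_order_zero n A (by omega) ((kerNum A B ε n).comp (X + C 1))
    (natDegree_kerNum_comp_add_two_le hAB hε n) (fun o K => cell A B ε n K (o + 1))
    (fun t ht => by rw [pfEval_cell hAB (by omega) n ht, brickKernel_succ_eq])
  simpa only [xCoeff, zero_add] using h

/-! ## The linear form `Σ_{k≥1} R_n(k) = Σ_s x_s(n)ζ(s) + x_0(n)` -/

/-- Cast: the rational brick kernel, read in `ℝ`. -/
theorem cast_brickKernel (A B ε n : ℕ) (t : ℚ) :
    ((brickKernel A B ε n t : ℚ) : ℝ) = brickKernel A B ε n (t : ℝ) := by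
  unfold brickKernel
  push_cast
  rfl

/-- `H_K^{(s)}` in the `Icc` form used by `cellZero`: `harm s K = Σ_{i=1}^{K} i^{−s}`. -/
theorem harm_eq_sum_Icc (s K : ℕ) : harm s K = ∑ i ∈ Icc 1 K, 1 / (i : ℚ) ^ s := by
  rw [harm, ← Finset.Ico_add_one_right_eq_Icc, Finset.sum_Ico_eq_sum_range, Nat.add_sub_cancel]
  refine Finset.sum_congr rfl fun m _ => ?_
  push_cast
  rw [add_comm]

/-- `x_0(n) = −Σ_{o<A} Σ_{K≤n} c_{K,o+1}(n)·H_K^{(o+1)}` — zi-p2's constant term is the Ball–Rivoal/CFR one. -/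
theorem xZero_eq_neg_sum (A B ε n : ℕ) :
    xZero A B ε n = -∑ o ∈ range A, ∑ K ∈ range (n + 1), cell A B ε n K (o + 1) * harm (o + 1) K := by
  rw [Finset.sum_comm, ← Finset.sum_neg_distrib, xZero]
  refine Finset.sum_congr rfl fun K _ => ?_
  rw [cellZero, ← Finset.Ico_add_one_right_eq_Icc, Finset.sum_Ico_eq_sum_range, Nat.add_sub_cancel]
  refine congrArg Neg.neg (Finset.sum_congr rfl fun o _ => ?_)
  rw [harm_eq_sum_Icc, add_comm 1 o]

/-- **THE LINEAR FORM** (what the docstrings of `BrickPartialFractions` assert): for `2B ≤ A` and `ε + 2 ≤ A`,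
`Σ_{k≥0} R_n(k+1) = Σ_{s=2}^{A} x_s(n)·ζ(s) + x_0(n)` as a convergent real series (`ζ(s) = zetaValue s`). -/
theorem hasSum_brickKernel {A B : ℕ} (hAB : 2 * B ≤ A) {ε : ℕ} (hε : ε + 2 ≤ A) (n : ℕ) :
    HasSum (fun k : ℕ => brickKernel A B ε n ((k : ℝ) + 1))
      (∑ s ∈ Icc 2 A, (xCoeff A B ε n s : ℝ) * zetaValue s + (xZero A B ε n : ℝ)) := by
  have hS := hasSum_partialFractions n A (by omega) (fun o K => cell A B ε n K (o + 1))
    (fun t => brickKernel A B ε n (t + 1)) (fun t ht => pfEval_cell hAB (by omega) n ht)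
    (by simpa only [xCoeff, zero_add] using xCoeff_one hAB hε n)
  beta_reduce at hS
  convert hS using 1
  · funext k
    rw [cast_brickKernel]
    push_cast
    rfl
  · rw [xZero_eq_neg_sum, sub_eq_add_neg]
    push_cast [xCoeff]
    congr 1
    rw [← Finset.Ico_add_one_right_eq_Icc, Finset.sum_Ico_eq_sum_range, Finset.sum_Ico_eq_sum_range,
      show A + 1 - 2 = A - 1 by omega]
    refine Finset.sum_congr rfl fun k _ => ?_
    rw [show 1 + k + 1 = 2 + k by ring]

/-! ## The very-well-poised reflection: only odd zeta values -/

/-- Reflection of the numerator: `kerNum(−n−x) = (−1)^ε·kerNum(x)` (the factor `x + n/2` is odd under `x ↦ −n−x`,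
the two Pochhammer blocks are exchanged, the power `n!^{A−2B}` is untouched). -/
theorem eval_kerNum_neg (A B ε n : ℕ) (x : ℚ) :
    (kerNum A B ε n).eval (-(n : ℚ) - x) = (-1) ^ ε * (kerNum A B ε n).eval x := by
  rw [eval_kerNum, eval_kerNum]
  have hc : ((-1 : ℚ)) ^ n = ∏ _m ∈ Icc 1 n, (-1 : ℚ) := by rw [prod_const, Nat.card_Icc, Nat.add_sub_cancel]
  have h1 : ∏ m ∈ Icc 1 n, (-(n : ℚ) - x - m) = (-1) ^ n * ∏ m ∈ Icc 1 n, (x + n + m) := by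
    rw [hc, ← prod_mul_distrib]
    exact prod_congr rfl fun m _ => by ring
  have h2 : ∏ m ∈ Icc 1 n, (-(n : ℚ) - x + n + m) = (-1) ^ n * ∏ m ∈ Icc 1 n, (x - m) := by
    rw [hc, ← prod_mul_distrib]
    exact prod_congr rfl fun m _ => by ring
  have h3 : (-(n : ℚ) - x + n / 2) ^ ε = (-1) ^ ε * (x + n / 2) ^ ε := by
    rw [← mul_pow]; congr 1; ring
  have hsq : ((-1 : ℚ) ^ n) ^ B * ((-1 : ℚ) ^ n) ^ B = 1 := by
    rw [← mul_pow, ← mul_pow, neg_one_mul, neg_neg, one_pow, one_pow]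
  rw [h1, h2, h3, mul_pow, mul_pow]
  linear_combination ((-1 : ℚ) ^ ε * (n ! : ℚ) ^ (A - 2 * B) * (x + n / 2) ^ ε *
    (∏ m ∈ Icc 1 n, (x - m)) ^ B * (∏ m ∈ Icc 1 n, (x + n + m)) ^ B) * hsq

/-- **The very-well-poised REFLECTION** in Cresson–Fischler–Rivoal's form: for `A` even and `ε` odd,
`kerNum(−n−X) = (−1)^{A(n+1)+1}·kerNum(X)` (the hypothesis of CFR's Théorème 1). -/
theorem kerNum_reflect {A : ℕ} (hA : Even A) (B : ℕ) {ε : ℕ} (hε : Odd ε) (n : ℕ) :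
    (kerNum A B ε n).comp (-(n : ℚ[X]) - X) = (-1 : ℚ[X]) ^ (A * (n + 1) + 1) * kerNum A B ε n := by
  apply Polynomial.funext
  intro x
  rw [eval_comp, eval_sub, eval_neg, eval_natCast, eval_X, eval_mul, eval_pow, eval_neg, eval_one,
    eval_kerNum_neg, hε.neg_one_pow, (hA.mul_right (n + 1)).add_one.neg_one_pow]

/-- **Only zeta values of odd argument**: for `A` even, `ε` odd (`ε < A`, `2B ≤ A`) and every EVEN `s` with
`2 ≤ s ≤ A`: `x_s(n) = 0` (Literature `CressonFischlerRivoal2008.partialFractions_sum_odd_order`). -/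
theorem xCoeff_eq_zero_of_even {A B : ℕ} (hAB : 2 * B ≤ A) (hA : Even A) {ε : ℕ} (hε : Odd ε) (hεA : ε < A)
    (n : ℕ) {s : ℕ} (hs : Even s) (hs2 : 2 ≤ s) (hsA : s ≤ A) : xCoeff A B ε n s = 0 := by
  have h := partialFractions_sum_odd_order n A (kerNum A B ε n) (kerNum_reflect hA B hε n)
    (fun o K => cell A B ε n K (o + 1)) (fun t ht => by rw [pfEval_cell hAB hεA n ht, brickKernel_succ_eq])
    (s - 1) (by omega) (by obtain ⟨m, hm⟩ := hs; exact ⟨m - 1, by omega⟩)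
  simpa only [xCoeff, Nat.sub_add_cancel (by omega : 1 ≤ s)] using h

/-- **THE LINEAR FORM IN ODD ZETA VALUES** (very-well-poised case `A` even, `ε` odd, `ε + 2 ≤ A`, `2B ≤ A`):
`Σ_{k≥0} R_n(k+1) = Σ_{3≤s≤A, s odd} x_s(n)·ζ(s) + x_0(n)`. -/
theorem hasSum_brickKernel_odd {A B : ℕ} (hAB : 2 * B ≤ A) (hA : Even A) {ε : ℕ} (hε : Odd ε)
    (hεA : ε + 2 ≤ A) (n : ℕ) :
    HasSum (fun k : ℕ => brickKernel A B ε n ((k : ℝ) + 1))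
      (∑ s ∈ (Icc 3 A).filter Odd, (xCoeff A B ε n s : ℝ) * zetaValue s + (xZero A B ε n : ℝ)) := by
  have h := hasSum_brickKernel hAB hεA n
  convert h using 2
  rw [← Finset.sum_filter_add_sum_filter_not (Icc 2 A) Odd]
  have hz : ∑ s ∈ (Icc 2 A).filter (fun s => ¬ Odd s), (xCoeff A B ε n s : ℝ) * zetaValue s = 0 := by
    refine Finset.sum_eq_zero fun s hs => ?_
    obtain ⟨hs, hso⟩ := mem_filter.1 hs
    rw [mem_Icc] at hs
    rw [xCoeff_eq_zero_of_even hAB hA hε (by omega) n (Nat.not_odd_iff_even.1 hso) hs.1 hs.2, Rat.cast_zero,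
      zero_mul]
  rw [hz, add_zero]
  congr 1
  ext s
  simp only [mem_filter, mem_Icc]
  constructor
  · rintro ⟨⟨h1, h2⟩, ho⟩
    exact ⟨⟨by omega, h2⟩, ho⟩
  · rintro ⟨⟨h1, h2⟩, ho⟩
    exact ⟨⟨by obtain ⟨m, rfl⟩ := ho; omega, h2⟩, ho⟩

/-- The same as an equality of the sum: `∑' k, R_n(k+1) = Σ_{3≤s≤A, s odd} x_s(n)ζ(s) + x_0(n)`. -/
theorem tsum_brickKernel_odd {A B : ℕ} (hAB : 2 * B ≤ A) (hA : Even A) {ε : ℕ} (hε : Odd ε)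
    (hεA : ε + 2 ≤ A) (n : ℕ) :
    ∑' k : ℕ, brickKernel A B ε n ((k : ℝ) + 1) =
      ∑ s ∈ (Icc 3 A).filter Odd, (xCoeff A B ε n s : ℝ) * zetaValue s + (xZero A B ε n : ℝ) :=
  (hasSum_brickKernel_odd hAB hA hε hεA n).tsum_eq

/-- The Ball kernel `(A,B,ε) = (4,1,1)` (`n!²Σ_k (k+n/2)(k−1)⋯(k−n)(k+n+1)⋯(k+2n)/(k⋯(k+n))⁴`):
`Σ_{k≥0} R_n(k+1) = x_3(n)·ζ(3) + x_0(n)` — a linear form in `1` and `ζ(3)` alone. -/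
theorem hasSum_ball (n : ℕ) :
    HasSum (fun k : ℕ => brickKernel 4 1 1 n ((k : ℝ) + 1))
      ((xCoeff 4 1 1 n 3 : ℝ) * zetaValue 3 + (xZero 4 1 1 n : ℝ)) := by
  have h := hasSum_brickKernel_odd (A := 4) (B := 1) (ε := 1) (by norm_num) ⟨2, rfl⟩ ⟨0, rfl⟩ (by norm_num) n
  have hset : (Icc 3 4).filter Odd = ({3} : Finset ℕ) := by decide
  simpa only [hset, sum_singleton] using h

/-! ## Zudilin 2002, eq. (7): `rₙ` is the kernel `(6,1,1)` -/

/-- `(x−n)_n = ∏_{m=1}^{n}(x−m)`. -/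
theorem poch_sub_natCast (x : ℚ) (n : ℕ) : poch (x - n) n = ∏ m ∈ Icc 1 n, (x - m) := by
  induction n with
  | zero => simp [poch]
  | succ n ih =>
    rw [Finset.prod_Icc_succ_top (by omega : 1 ≤ n + 1), ← ih, poch, poch, Finset.prod_range_succ']
    congr 1
    · refine Finset.prod_congr rfl fun s _ => ?_
      push_cast; ring
    · push_cast; ring

/-- `(x+n+1)_n = ∏_{m=1}^{n}(x+n+m)`. -/
theorem poch_add_natCast_succ (x : ℚ) (n : ℕ) : poch (x + n + 1) n = ∏ m ∈ Icc 1 n, (x + n + m) := by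
  rw [poch, ← Finset.Ico_add_one_right_eq_Icc, Finset.prod_Ico_eq_prod_range, Nat.add_sub_cancel]
  refine Finset.prod_congr rfl fun s _ => ?_
  push_cast; ring

/-- **Zudilin's numerator (7) IS the tree's `kerNum 6 1 1 n`**: `n!⁴(x+n/2)(x−n)_n(x+n+1)_n = kerNum 6 1 1 n (x)`. -/
theorem eval_numR_eq_eval_kerNum (n : ℕ) (x : ℚ) : (numR n).eval x = (kerNum 6 1 1 n).eval x := by
  rw [eval_numR, eval_kerNum, poch_sub_natCast, poch_add_natCast_succ]
  norm_num
  ring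

/-- **The tree's cells are partial-fraction data of Zudilin's summand** (`Zudilin2002.IsDataR`). -/
theorem isDataR_cell (n : ℕ) : IsDataR n (fun o K => cell 6 1 1 n K (o + 1)) := fun t ht => by
  rw [pfEval_cell (by norm_num) (by norm_num) n ht, brickKernel_succ_eq, eval_comp, eval_comp,
    eval_numR_eq_eval_kerNum]

/-- Zudilin's (chosen) partial-fraction data agree with the cells on the support `o < 6`, `K ≤ n`. -/
theorem dataR_eq_cell (n : ℕ) {o K : ℕ} (ho : o < 6) (hK : K ≤ n) : dataR n o K = cell 6 1 1 n K (o + 1) :=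
  (isDataR_dataR n).eq (isDataR_cell n) ho hK

/-- **`uₙ = x_5(n)`**: Zudilin's `ζ(5)`-coefficient of `rₙ` is zi-p2's `x_5` of the kernel `(6,1,1)`. -/
theorem uC_eq_xCoeff (n : ℕ) : uC n = xCoeff 6 1 1 n 5 := by
  rw [uC, xCoeff]
  exact Finset.sum_congr rfl fun K hK => dataR_eq_cell n (by norm_num) (by have := mem_range.1 hK; omega)

/-- **`wₙ = x_3(n)`**: Zudilin's `ζ(3)`-coefficient of `rₙ` is zi-p2's `x_3` of the kernel `(6,1,1)`. -/
theorem wC_eq_xCoeff (n : ℕ) : wC n = xCoeff 6 1 1 n 3 := by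
  rw [wC, xCoeff]
  exact Finset.sum_congr rfl fun K hK => dataR_eq_cell n (by norm_num) (by have := mem_range.1 hK; omega)

/-- **`vₙ = −x_0(n)`**: Zudilin's constant term of `rₙ` (with its sign, `rₙ = … − vₙ`) is minus zi-p2's `x_0`. -/
theorem vC_eq_neg_xZero (n : ℕ) : vC n = -xZero 6 1 1 n := by
  rw [xZero_eq_neg_sum, neg_neg, vC]
  refine Finset.sum_congr rfl fun o ho => Finset.sum_congr rfl fun K hK => ?_
  rw [dataR_eq_cell n (mem_range.1 ho) (by have := mem_range.1 hK; omega)]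

/-- Zudilin's decomposition `rₙ = uₙζ(5) + wₙζ(3) − vₙ` in zi-p2's coordinates:
`rₙ = x_5(n)ζ(5) + x_3(n)ζ(3) + x_0(n)` for the kernel `(6,1,1)`. -/
theorem rForm_eq_xCoeff (n : ℕ) :
    rForm n = (xCoeff 6 1 1 n 5 : ℝ) * zetaValue 5 + (xCoeff 6 1 1 n 3 : ℝ) * zetaValue 3 + (xZero 6 1 1 n : ℝ) := by
  rw [rForm_eq, uC_eq_xCoeff, wC_eq_xCoeff, vC_eq_neg_xZero, Rat.cast_neg, sub_neg_eq_add]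

/-! ## COROLLARIES of THEOREM 10: supercongruences for Zudilin's `uₙ, wₙ, vₙ` and for the Ball kernel -/

section supercongruence

variable {p : ℕ} [Fact p.Prime]

/-- **`u_{np} ≡ u_n (mod p³)`**: for every prime `p ≥ 5` and EVERY `n`, `v_p(u_{np} − u_n) ≥ 3` (or `u_{np} = u_n`),
where `uₙ` is the `ζ(5)`-coefficient of Zudilin's `rₙ` (2002, eq. (7)) — THEOREM 10 (viii), cell `s = 5`, `τ_5 = 0`. -/
theorem uC_congr (h3 : 3 < p) (n : ℕ) : Rat.padicValuation p (uC (n * p) - uC n) ≤ exp (-3) := by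
  have h := (theoremTen_all (A := 6) (B := 1) h3 ⟨3, rfl⟩ le_rfl (by norm_num) (by norm_num) n).1 5
    (by norm_num)
  simpa only [uC_eq_xCoeff, show 6 - 1 - 5 = 0 from rfl, mul_zero, pow_zero, one_mul] using h

/-- **`p^{2(L+1)}w_{np} ≡ p^{2L}w_n (mod p³)`** for `n < p^{L+1}`, `p ≥ 5` prime, `wₙ` the `ζ(3)`-coefficient of
Zudilin's `rₙ` — THEOREM 10 (viii), cell `s = 3`, `τ_3 = 2`. -/
theorem wC_congr (h3 : 3 < p) {L n : ℕ} (hn : n < p ^ (L + 1)) :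
    Rat.padicValuation p ((p : ℚ) ^ (2 * (L + 1)) * wC (n * p) - (p : ℚ) ^ (2 * L) * wC n) ≤ exp (-3) := by
  have h := (theoremTen (A := 6) (B := 1) h3 ⟨3, rfl⟩ le_rfl (by norm_num) (by norm_num) hn).1 3 (by norm_num)
  rw [mul_comm 2 (L + 1), mul_comm 2 L]
  simpa only [wC_eq_xCoeff, show 6 - 1 - 3 = 2 from rfl] using h

/-- **`p^{5(L+1)}v_{np} ≡ p^{5L}v_n (mod p³)`** for `n < p^{L+1}`, `p ≥ 5` prime, `vₙ` the constant term of
Zudilin's `rₙ` — THEOREM 10 (viii), the harmonic cell, `τ_0 = 5`. -/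
theorem vC_congr (h3 : 3 < p) {L n : ℕ} (hn : n < p ^ (L + 1)) :
    Rat.padicValuation p ((p : ℚ) ^ (5 * (L + 1)) * vC (n * p) - (p : ℚ) ^ (5 * L) * vC n) ≤ exp (-3) := by
  have h := (theoremTen (A := 6) (B := 1) h3 ⟨3, rfl⟩ le_rfl (by norm_num) (by norm_num) hn).2
  rw [vC_eq_neg_xZero, vC_eq_neg_xZero, mul_neg, mul_neg, neg_sub_neg, Valuation.map_sub_swap,
    mul_comm 5 (L + 1), mul_comm 5 L]
  simpa only [show 6 - 1 = 5 from rfl] using h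

/-- The Ball kernel `(4,1,1)`: **`x_3(np) ≡ x_3(n) (mod p³)` for EVERY `n`** and
`p^{3(L+1)}x_0(np) ≡ p^{3L}x_0(n) (mod p³)` for `n < p^{L+1}` (`p ≥ 5` prime) — THEOREM 10 (viii) at `(A,B) = (4,1)`,
i.e. Apéry-type supercongruences for both coefficients of the linear forms `x_3(n)ζ(3) + x_0(n)` of `hasSum_ball`. -/
theorem ball_congr (h3 : 3 < p) {L n : ℕ} (hn : n < p ^ (L + 1)) :
    Rat.padicValuation p (xCoeff 4 1 1 (n * p) 3 - xCoeff 4 1 1 n 3) ≤ exp (-3) ∧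
      Rat.padicValuation p ((p : ℚ) ^ (3 * (L + 1)) * xZero 4 1 1 (n * p) -
        (p : ℚ) ^ (3 * L) * xZero 4 1 1 n) ≤ exp (-3) := by
  obtain ⟨hS, hZ⟩ := theoremTen (A := 4) (B := 1) h3 ⟨2, rfl⟩ le_rfl (by norm_num) (by norm_num) hn
  refine ⟨?_, ?_⟩
  · simpa only [show 4 - 1 - 3 = 0 from rfl, mul_zero, pow_zero, one_mul] using hS 3 (by norm_num)
  · rw [mul_comm 3 (L + 1), mul_comm 3 L]
    simpa only [show 4 - 1 = 3 from rfl] using hZ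

end supercongruence

end

end Summit.KontsevichZagierPeriods.Zeta5Search.BrickLinearForms
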